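import Summits.Parity.GeneralizedHardyLittlewood.Theorems.PrimeLevelFamEdgeMomentsBeyondDiagonalDiagBoseSymm
import Mathlib.Analysis.SpecialFunctions.ImproperIntegrals
import Mathlib.MeasureTheory.Integral.IntegralEqImproper
import HarnessLib

/-!
# Route `PrimeLevelFamEdge`, crux K_A `MomentsBeyondDiagonal` (stmt-Parity-20007), line «petersson_layers» v4, stub `stub_diag`:
# **census R2, mixed Bose coefficients — the unit-box model integral in RATIO COORDINATES**

For the mixed two-dimensional Bose coefficients `c_ab(y)` (`…DiagBoseOuter.bose_expand`, p812352) the kernel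
`B(φ) = e^{−φ}(1−e^{−φ})^{−2}` is `1/φ² + O(1)` on the unit box (`…DiagBoseKernel2`), so the leading small-`y` behaviour is
carried by the MODEL INTEGRAL
`M_ab(y) = ∫∫_{0<u₁,u₂≤1, u₁u₂>y} (log u₁)^a (log u₂)^b (u₁+u₂)^{−2} du₁ du₂`.
The kernel `(u₁+u₂)^{−2}` is homogeneous of degree `−2`, so the ratio coordinate `u₂ = r·u₁` separates it: after one Fubini
exchange the `u₁`-integral is the elementary `∫ (log u₁)^n du₁/u₁` over `(√(y/r), min(1,1/r)]`, and

* `box_eq_ratio_integral` — **`M_ab(y) = ∫_{y<r<1/y} (1+r)^{−2} Σ_{k≤b} C(b,k)(log r)^{b−k}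
  ((−max(log r,0))^{a+k+1} − (log(y/r)/2)^{a+k+1})/(a+k+1) dr`** (`y > 0`).

Tools: `integrableOn_one_add_abs_log_pow_div_sq` (`(1+|log r|)^N(1+r)^{−2}` is integrable on `(0,∞)`),
`integral_log_pow_div` (`∫_s^t (log u)^n/u`), the substitution `box_inner_subst`, the product integrability
`integrable_boxRatio`, and the closed-form inner integral `box_ratio_inner`.

Def-free; theorems only. Helper `--supports stmt-Parity-20007`; closes nothing; K_A, K_B and the Parity summit are NOT
proved; nothing about Landau–Siegel zeros.

## References
* E. Kowalski, P. Michel, J. VanderKam, J. reine angew. Math. 526 (2000), (22)–(28) pp. 12–15.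
  [cite: KowalskiMichelVanderKam2000, (22)–(28) — derivation (residues of the diagonal weight, real-variable form)]
-/

noncomputable section

open Real Set MeasureTheory Filter Function Finset

namespace Summit.Parity.GeneralizedHardyLittlewood.Theorems.MomentsBeyondDiagonal.DiagLines

/-! ## §1. One-variable tools -/

/-- `r ↦ (1+|log r|)^N (1+r)^{−2}` is integrable on `(0, ∞)`. [folklore] -/
theorem integrableOn_one_add_abs_log_pow_div_sq (N : ℕ) :
    IntegrableOn (fun r : ℝ ↦ (1 + |Real.log r|) ^ N / (1 + r) ^ 2) (Ioi 0) := by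
  have hmeas : Measurable (fun r : ℝ ↦ (1 + |Real.log r|) ^ N / (1 + r) ^ 2) :=
    ((measurable_const.add Real.measurable_log.abs).pow_const N).div ((measurable_const.add measurable_id).pow_const 2)
  rw [← Ioc_union_Ioi_eq_Ioi zero_le_one]
  refine IntegrableOn.union ?_ ?_
  · -- `(0, 1]`: `1 + |log r| = |−1 + log r|`, dominated by `e · e^{−r} |−1 + log r|^N`
    have hmaj : IntegrableOn (fun r : ℝ ↦ Real.exp 1 * (Real.exp (-r) * |(-1 : ℝ) + Real.log r| ^ N)) (Ioc 0 1) :=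
      ((integrableOn_exp_neg_mul_abs_logPow (-1) N).mono_set Ioc_subset_Ioi_self).const_mul _
    refine Integrable.mono' hmaj hmeas.aestronglyMeasurable ?_
    rw [ae_restrict_iff' measurableSet_Ioc]
    refine ae_of_all _ fun r hr ↦ ?_
    obtain ⟨hr0, hr1⟩ := hr
    have hlog : Real.log r ≤ 0 := Real.log_nonpos hr0.le hr1
    have habs : 1 + |Real.log r| = |(-1 : ℝ) + Real.log r| := by
      rw [abs_of_nonpos hlog, abs_of_nonpos (by linarith)]; ring
    have hnum0 : 0 ≤ (1 + |Real.log r|) ^ N := by positivity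
    have hden1 : 1 ≤ (1 + r) ^ 2 := by nlinarith
    have he : 1 ≤ Real.exp 1 * Real.exp (-r) := by
      rw [← Real.exp_add]; exact Real.one_le_exp (by linarith)
    rw [Real.norm_eq_abs, abs_of_nonneg (div_nonneg hnum0 (by positivity))]
    calc (1 + |Real.log r|) ^ N / (1 + r) ^ 2 ≤ (1 + |Real.log r|) ^ N := div_le_self hnum0 hden1
      _ ≤ (Real.exp 1 * Real.exp (-r)) * (1 + |Real.log r|) ^ N := le_mul_of_one_le_left hnum0 he
      _ = Real.exp 1 * (Real.exp (-r) * |(-1 : ℝ) + Real.log r| ^ N) := by rw [habs]; ring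
  · -- `(1, ∞)`: `log r ≤ r^ε/ε`, `ε = 1/(2(N+1))`, so the integrand is `≤ C r^{−3/2}`
    set ε : ℝ := 1 / (2 * ((N : ℝ) + 1)) with hε
    have hε0 : 0 < ε := by rw [hε]; positivity
    have hεN : ε * N ≤ 1 / 2 := by
      rw [hε]
      have hN : (N : ℝ) ≤ (N : ℝ) + 1 := by linarith
      rw [div_mul_eq_mul_div, one_mul, div_le_div_iff₀ (by positivity) (by norm_num)]
      nlinarith
    set C : ℝ := (1 + 1 / ε) ^ N with hC
    have hmaj : IntegrableOn (fun r : ℝ ↦ C * r ^ (-(3 / 2) : ℝ)) (Ioi 1) :=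
      (integrableOn_Ioi_rpow_of_lt (by norm_num) one_pos).const_mul C
    refine Integrable.mono' hmaj hmeas.aestronglyMeasurable ?_
    rw [ae_restrict_iff' measurableSet_Ioi]
    refine ae_of_all _ fun r hr ↦ ?_
    have hr1 : 1 < r := hr
    have hr0 : 0 < r := one_pos.trans hr1
    have hlog0 : 0 ≤ Real.log r := Real.log_nonneg hr1.le
    have hlogle : Real.log r ≤ r ^ ε / ε := Real.log_le_rpow_div hr0.le hε0
    have hrε1 : 1 ≤ r ^ ε := Real.one_le_rpow hr1.le hε0.le
    have h1 : 1 + |Real.log r| ≤ (1 + 1 / ε) * r ^ ε := by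
      rw [abs_of_nonneg hlog0]
      calc 1 + Real.log r ≤ r ^ ε + r ^ ε / ε := add_le_add hrε1 hlogle
        _ = (1 + 1 / ε) * r ^ ε := by ring
    have h2 : (1 + |Real.log r|) ^ N ≤ C * r ^ (ε * N) := by
      calc (1 + |Real.log r|) ^ N ≤ ((1 + 1 / ε) * r ^ ε) ^ N := pow_le_pow_left₀ (by positivity) h1 N
        _ = C * r ^ (ε * N) := by rw [mul_pow, hC, ← Real.rpow_natCast (r ^ ε) N, ← Real.rpow_mul hr0.le]
    have h3 : r ^ (ε * N) ≤ r ^ (1 / 2 : ℝ) := Real.rpow_le_rpow_of_exponent_le hr1.le hεN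
    have hden : r ^ (2 : ℝ) ≤ (1 + r) ^ 2 := by
      rw [Real.rpow_two]; nlinarith
    have hnum0 : 0 ≤ (1 + |Real.log r|) ^ N := by positivity
    rw [Real.norm_eq_abs, abs_of_nonneg (div_nonneg hnum0 (by positivity))]
    calc (1 + |Real.log r|) ^ N / (1 + r) ^ 2 ≤ (C * r ^ (1 / 2 : ℝ)) / r ^ (2 : ℝ) := by
          gcongr
          exact h2.trans (mul_le_mul_of_nonneg_left h3 (by positivity))
      _ = C * r ^ (-(3 / 2) : ℝ) := by
          rw [mul_div_assoc, ← Real.rpow_sub hr0]; norm_num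

/-- `∫_s^t (log u)^n du/u = ((log t)^{n+1} − (log s)^{n+1})/(n+1)` for `0 < s ≤ t`. [folklore] -/
theorem integral_log_pow_div (n : ℕ) {s t : ℝ} (hs : 0 < s) (hst : s ≤ t) :
    ∫ u in s..t, Real.log u ^ n / u = (Real.log t ^ (n + 1) - Real.log s ^ (n + 1)) / ((n : ℝ) + 1) := by
  have hn1 : (n : ℝ) + 1 ≠ 0 := by positivity
  have hderiv : ∀ u ∈ uIcc s t, HasDerivAt (fun u : ℝ ↦ Real.log u ^ (n + 1) / ((n : ℝ) + 1)) (Real.log u ^ n / u) u := by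
    intro u hu
    rw [uIcc_of_le hst] at hu
    have hu0 : 0 < u := lt_of_lt_of_le hs hu.1
    have h := ((Real.hasDerivAt_log hu0.ne').pow (n + 1)).div_const ((n : ℝ) + 1)
    refine h.congr_deriv ?_
    rw [Nat.add_sub_cancel]
    field_simp
    push_cast
    ring
  have hcont : ContinuousOn (fun u : ℝ ↦ Real.log u ^ n / u) (uIcc s t) := by
    rw [uIcc_of_le hst]
    refine ContinuousOn.div ((continuousOn_log.mono fun u hu ↦ ?_).pow n) continuousOn_id fun u hu ↦ ?_
    · exact ne_of_gt (lt_of_lt_of_le hs hu.1)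
    · exact ne_of_gt (lt_of_lt_of_le hs hu.1)
  rw [intervalIntegral.integral_eq_sub_of_hasDerivAt hderiv hcont.intervalIntegrable]
  field_simp

/-! ## §2. The ratio substitution `u₂ = r·u₁` in the inner integral -/

/-- **Inner substitution.** For `u > 0`:
`∫_{u₂>0} 1[y<u u₂, u ≤ 1, u₂ ≤ 1](log u)^a(log u₂)^b/(u+u₂)² du₂
   = ∫_{r>0} 1[u ≤ 1, u r ≤ 1, y < u²r](log u)^a(log(u r))^b/(u(1+r)²) dr`. [folklore] -/
theorem box_inner_subst (y : ℝ) {u : ℝ} (hu : 0 < u) (a b : ℕ) :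
    ∫ u₂ in Ioi (0 : ℝ), (if 0 < u ∧ 0 < u₂ ∧ y < u * u₂ ∧ u ≤ 1 ∧ u₂ ≤ 1 then
        Real.log u ^ a * Real.log u₂ ^ b / (u + u₂) ^ 2 else 0) =
      ∫ r in Ioi (0 : ℝ), (if 0 < u ∧ 0 < r ∧ u ≤ 1 ∧ u * r ≤ 1 ∧ y < u ^ 2 * r then
        Real.log u ^ a * Real.log (u * r) ^ b / (u * (1 + r) ^ 2) else 0) := by
  set g : ℝ → ℝ := fun u₂ ↦ if 0 < u ∧ 0 < u₂ ∧ y < u * u₂ ∧ u ≤ 1 ∧ u₂ ≤ 1 then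
      Real.log u ^ a * Real.log u₂ ^ b / (u + u₂) ^ 2 else 0 with hg
  have hsub := MeasureTheory.integral_comp_mul_left_Ioi g 0 hu
  rw [mul_zero, smul_eq_mul] at hsub
  have hLHS : ∫ u₂ in Ioi (0 : ℝ), g u₂ = u * ∫ r in Ioi (0 : ℝ), g (u * r) := by
    rw [hsub, ← mul_assoc, mul_inv_cancel₀ hu.ne', one_mul]
  rw [hLHS, ← integral_const_mul]
  refine setIntegral_congr_fun measurableSet_Ioi fun r hr ↦ ?_
  have hr : 0 < r := hr
  simp only [hg]
  have hur : 0 < u * r := mul_pos hu hr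
  by_cases hc : u ≤ 1 ∧ u * r ≤ 1 ∧ y < u ^ 2 * r
  · have hc' : 0 < u ∧ 0 < u * r ∧ y < u * (u * r) ∧ u ≤ 1 ∧ u * r ≤ 1 :=
      ⟨hu, hur, by nlinarith [hc.2.2], hc.1, hc.2.1⟩
    rw [if_pos hc', if_pos ⟨hu, hr, hc⟩]
    have hne : (u + u * r) ^ 2 ≠ 0 := by positivity
    field_simp
  · have hc' : ¬ (0 < u ∧ 0 < u * r ∧ y < u * (u * r) ∧ u ≤ 1 ∧ u * r ≤ 1) := by
      rintro ⟨-, -, h3, h4, h5⟩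
      exact hc ⟨h4, h5, by nlinarith [h3]⟩
    rw [if_neg hc', if_neg (fun h ↦ hc h.2.2), mul_zero]

/-- Measurability of the ratio-coordinate integrand. [folklore] -/
theorem measurable_boxRatio (y : ℝ) (a b : ℕ) :
    Measurable (uncurry fun u r : ℝ ↦ if 0 < u ∧ 0 < r ∧ u ≤ 1 ∧ u * r ≤ 1 ∧ y < u ^ 2 * r then
        Real.log u ^ a * Real.log (u * r) ^ b / (u * (1 + r) ^ 2) else 0) := by
  have h1 : Measurable fun p : ℝ × ℝ ↦ Real.log p.1 ^ a * Real.log (p.1 * p.2) ^ b / (p.1 * (1 + p.2) ^ 2) :=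
    (((Real.measurable_log.comp measurable_fst).pow_const a).mul
      ((Real.measurable_log.comp (measurable_fst.mul measurable_snd)).pow_const b)).div
      (measurable_fst.mul ((measurable_const.add measurable_snd).pow_const 2))
  refine Measurable.ite ?_ h1 measurable_const
  exact (measurableSet_lt measurable_const measurable_fst).inter
    ((measurableSet_lt measurable_const measurable_snd).inter
      ((measurableSet_le measurable_fst measurable_const).inter
        ((measurableSet_le (measurable_fst.mul measurable_snd) measurable_const).inter
          (measurableSet_lt measurable_const ((measurable_fst.pow_const 2).mul measurable_snd)))))

/-- **Integrability of the ratio-coordinate integrand on `(0,∞)²`** (`y > 0`): on its support `u > y`, so it is dominated by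
the product `y⁻¹ e·e^{−u}|−1+log u|^{a+b} · (1+|log r|)^b(1+r)^{−2}`. [folklore] -/
theorem integrable_boxRatio {y : ℝ} (hy : 0 < y) (a b : ℕ) :
    Integrable (uncurry fun u r : ℝ ↦ if 0 < u ∧ 0 < r ∧ u ≤ 1 ∧ u * r ≤ 1 ∧ y < u ^ 2 * r then
        Real.log u ^ a * Real.log (u * r) ^ b / (u * (1 + r) ^ 2) else 0)
      ((volume.restrict (Ioi (0 : ℝ))).prod (volume.restrict (Ioi (0 : ℝ)))) := by
  have hA : Integrable (fun u : ℝ ↦ y⁻¹ * Real.exp 1 * (Real.exp (-u) * |(-1 : ℝ) + Real.log u| ^ (a + b)))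
      (volume.restrict (Ioi (0 : ℝ))) :=
    (integrableOn_exp_neg_mul_abs_logPow (-1) (a + b)).const_mul _
  have hB : Integrable (fun r : ℝ ↦ (1 + |Real.log r|) ^ b / (1 + r) ^ 2) (volume.restrict (Ioi (0 : ℝ))) :=
    integrableOn_one_add_abs_log_pow_div_sq b
  have hmaj := hA.mul_prod hB
  refine Integrable.mono' hmaj (measurable_boxRatio y a b).aestronglyMeasurable (ae_of_all _ fun p ↦ ?_)
  simp only [uncurry]
  by_cases hc : 0 < p.1 ∧ 0 < p.2 ∧ p.1 ≤ 1 ∧ p.1 * p.2 ≤ 1 ∧ y < p.1 ^ 2 * p.2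
  · rw [if_pos hc]
    obtain ⟨hu, hr, hu1, hur, hyur⟩ := hc
    -- `u > y`
    have hyu : y < p.1 := by nlinarith
    have hinv : p.1⁻¹ ≤ y⁻¹ := by rw [inv_le_inv₀ hu hy]; exact hyu.le
    have hlogu : Real.log p.1 ≤ 0 := Real.log_nonpos hu.le hu1
    have habs1 : 1 + |Real.log p.1| = |(-1 : ℝ) + Real.log p.1| := by
      rw [abs_of_nonpos hlogu, abs_of_nonpos (by linarith)]; ring
    have he : 1 ≤ Real.exp 1 * Real.exp (-p.1) := by
      rw [← Real.exp_add]; exact Real.one_le_exp (by linarith)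
    have hlogur : |Real.log (p.1 * p.2)| ≤ (1 + |Real.log p.1|) * (1 + |Real.log p.2|) := by
      rw [Real.log_mul hu.ne' hr.ne']
      calc |Real.log p.1 + Real.log p.2| ≤ |Real.log p.1| + |Real.log p.2| := abs_add_le _ _
        _ ≤ (1 + |Real.log p.1|) * (1 + |Real.log p.2|) := by
            nlinarith [abs_nonneg (Real.log p.1), abs_nonneg (Real.log p.2)]
    rw [norm_div, norm_mul, norm_pow, norm_pow, Real.norm_eq_abs, Real.norm_eq_abs, norm_mul, norm_pow,
      Real.norm_of_nonneg hu.le, Real.norm_of_nonneg (by positivity : (0 : ℝ) ≤ 1 + p.2)]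
    have hX0 : 0 ≤ 1 + |Real.log p.1| := by positivity
    have hZ0 : 0 ≤ 1 + |Real.log p.2| := by positivity
    calc |Real.log p.1| ^ a * |Real.log (p.1 * p.2)| ^ b / (p.1 * (1 + p.2) ^ 2)
        ≤ (1 + |Real.log p.1|) ^ a * ((1 + |Real.log p.1|) * (1 + |Real.log p.2|)) ^ b / (p.1 * (1 + p.2) ^ 2) := by
          gcongr
          exact le_add_of_nonneg_left zero_le_one
      _ = (1 + |Real.log p.1|) ^ (a + b) * p.1⁻¹ * ((1 + |Real.log p.2|) ^ b / (1 + p.2) ^ 2) := by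
          rw [mul_pow, pow_add]; field_simp
      _ ≤ (1 + |Real.log p.1|) ^ (a + b) * y⁻¹ * ((1 + |Real.log p.2|) ^ b / (1 + p.2) ^ 2) := by gcongr
      _ ≤ (Real.exp 1 * Real.exp (-p.1)) * (1 + |Real.log p.1|) ^ (a + b) * y⁻¹ *
            ((1 + |Real.log p.2|) ^ b / (1 + p.2) ^ 2) := by
          gcongr
          exact le_mul_of_one_le_left (by positivity) he
      _ = y⁻¹ * Real.exp 1 * (Real.exp (-p.1) * |(-1 : ℝ) + Real.log p.1| ^ (a + b)) *
            ((1 + |Real.log p.2|) ^ b / (1 + p.2) ^ 2) := by rw [← habs1]; ring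
  · rw [if_neg hc, norm_zero]
    exact mul_nonneg (mul_nonneg (by positivity) (by positivity)) (by positivity)

/-! ## §3. The closed-form inner `u`-integral -/

/-- For `y, r > 0`: the guard `0<u, u ≤ 1, u r ≤ 1, y < u² r` is membership in `(√(y/r), min(1, 1/r)]`. -/
theorem boxRatio_guard_iff {y r : ℝ} (hy : 0 < y) (hr : 0 < r) (u : ℝ) :
    (0 < u ∧ 0 < r ∧ u ≤ 1 ∧ u * r ≤ 1 ∧ y < u ^ 2 * r) ↔ u ∈ Ioc (Real.sqrt (y / r)) (min 1 r⁻¹) := by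
  have hs0 : 0 < Real.sqrt (y / r) := Real.sqrt_pos.2 (div_pos hy hr)
  constructor
  · rintro ⟨hu, -, hu1, hur, hyur⟩
    refine ⟨?_, le_min hu1 ?_⟩
    · rw [Real.sqrt_lt' hu, div_lt_iff₀ hr]; exact hyur
    · rw [← one_div, le_div_iff₀ hr]; exact hur
  · rintro ⟨hsu, hut⟩
    have hu : 0 < u := hs0.trans hsu
    have hu1 : u ≤ 1 := hut.trans (min_le_left _ _)
    have hur' : u ≤ r⁻¹ := hut.trans (min_le_right _ _)
    refine ⟨hu, hr, hu1, ?_, ?_⟩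
    · rw [← one_div, le_div_iff₀ hr] at hur'; exact hur'
    · rw [Real.sqrt_lt' hu, div_lt_iff₀ hr] at hsu; exact hsu

/-- For `y, r > 0`: `√(y/r) < min(1,1/r) ↔ y < r < 1/y`. -/
theorem sqrt_lt_min_iff {y r : ℝ} (hy : 0 < y) (hr : 0 < r) :
    Real.sqrt (y / r) < min 1 r⁻¹ ↔ y < r ∧ r < y⁻¹ := by
  rw [lt_min_iff, Real.sqrt_lt' one_pos, Real.sqrt_lt' (inv_pos.2 hr), one_pow, div_lt_one hr,
    div_lt_iff₀ hr]
  have h : r⁻¹ ^ 2 * r = r⁻¹ := by field_simp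
  rw [h, lt_inv_comm₀ hy hr]

/-- **The inner `u`-integral in closed form.** For `y, r > 0`:
`∫_{u>0} 1[u ≤ 1, u r ≤ 1, y < u² r](log u)^a(log(u r))^b/(u(1+r)²) du
   = 1[y<r<1/y]·(1+r)^{−2} Σ_{k≤b} C(b,k)(log r)^{b−k}((−max(log r,0))^{a+k+1} − (log(y/r)/2)^{a+k+1})/(a+k+1)`. [folklore] -/
theorem box_ratio_inner {y r : ℝ} (hy : 0 < y) (hr : 0 < r) (a b : ℕ) :
    ∫ u in Ioi (0 : ℝ), (if 0 < u ∧ 0 < r ∧ u ≤ 1 ∧ u * r ≤ 1 ∧ y < u ^ 2 * r then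
        Real.log u ^ a * Real.log (u * r) ^ b / (u * (1 + r) ^ 2) else 0) =
      if y < r ∧ r < y⁻¹ then
        (∑ k ∈ Finset.range (b + 1), (b.choose k : ℝ) * Real.log r ^ (b - k) *
          ((-(max (Real.log r) 0)) ^ (a + k + 1) - (Real.log (y / r) / 2) ^ (a + k + 1)) / ((a : ℝ) + k + 1)) /
          (1 + r) ^ 2
      else 0 := by
  set s : ℝ := Real.sqrt (y / r) with hs
  set t : ℝ := min 1 r⁻¹ with ht
  have hs0 : 0 < s := Real.sqrt_pos.2 (div_pos hy hr)
  set F : ℝ → ℝ := fun u ↦ Real.log u ^ a * Real.log (u * r) ^ b / (u * (1 + r) ^ 2) with hF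
  -- the guarded integrand is an indicator
  have hind : (fun u : ℝ ↦ if 0 < u ∧ 0 < r ∧ u ≤ 1 ∧ u * r ≤ 1 ∧ y < u ^ 2 * r then
      Real.log u ^ a * Real.log (u * r) ^ b / (u * (1 + r) ^ 2) else 0) = (Ioc s t).indicator F := by
    funext u
    by_cases hc : 0 < u ∧ 0 < r ∧ u ≤ 1 ∧ u * r ≤ 1 ∧ y < u ^ 2 * r
    · rw [if_pos hc, indicator_of_mem ((boxRatio_guard_iff hy hr u).1 hc)]
    · rw [if_neg hc, indicator_of_notMem (fun h ↦ hc ((boxRatio_guard_iff hy hr u).2 h))]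
  have hsub : Ioc s t ⊆ Ioi 0 := fun u hu ↦ hs0.trans hu.1
  rw [hind, setIntegral_indicator measurableSet_Ioc, inter_eq_right.2 hsub]
  by_cases hst : s < t
  · have hyr : y < r ∧ r < y⁻¹ := (sqrt_lt_min_iff hy hr).1 hst
    rw [if_pos hyr, ← intervalIntegral.integral_of_le hst.le]
    -- expand the integrand on `[s, t]`
    have hlogs : Real.log s = Real.log (y / r) / 2 := by rw [hs, Real.log_sqrt (div_pos hy hr).le]
    have hlogt : Real.log t = -(max (Real.log r) 0) := by
      rcases le_or_gt r 1 with hr1 | hr1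
      · have : t = 1 := by rw [ht, min_eq_left]; exact one_le_inv_iff₀.2 ⟨hr, hr1⟩
        rw [this, Real.log_one, max_eq_right (Real.log_nonpos hr.le hr1), neg_zero]
      · have : t = r⁻¹ := by rw [ht, min_eq_right]; exact inv_le_one_of_one_le₀ hr1.le
        rw [this, Real.log_inv, max_eq_left (Real.log_nonneg hr1.le)]
    have hexp : ∀ u ∈ uIcc s t, F u = ∑ k ∈ Finset.range (b + 1),
        ((b.choose k : ℝ) * Real.log r ^ (b - k) / (1 + r) ^ 2) * (Real.log u ^ (a + k) / u) := by
      intro u hu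
      rw [uIcc_of_le hst.le] at hu
      have hu0 : 0 < u := hs0.trans_le hu.1
      rw [hF]
      simp only
      rw [Real.log_mul hu0.ne' hr.ne', add_pow, Finset.mul_sum, Finset.sum_div]
      refine Finset.sum_congr rfl fun k _ ↦ ?_
      rw [pow_add]
      field_simp
    have hcont : ∀ k : ℕ, IntervalIntegrable (fun u : ℝ ↦ Real.log u ^ (a + k) / u) volume s t := by
      intro k
      refine ContinuousOn.intervalIntegrable ?_
      rw [uIcc_of_le hst.le]
      refine ContinuousOn.div ((continuousOn_log.mono fun u hu ↦ ?_).pow _) continuousOn_id fun u hu ↦ ?_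
      · exact ne_of_gt (hs0.trans_le hu.1)
      · exact ne_of_gt (hs0.trans_le hu.1)
    rw [intervalIntegral.integral_congr hexp,
      intervalIntegral.integral_finsetSum fun k _ ↦ (hcont k).const_mul _, Finset.sum_div]
    refine Finset.sum_congr rfl fun k _ ↦ ?_
    rw [intervalIntegral.integral_const_mul, integral_log_pow_div (a + k) hs0 hst.le, hlogt, hlogs]
    push_cast
    field_simp
  · have hyr : ¬ (y < r ∧ r < y⁻¹) := fun h ↦ hst ((sqrt_lt_min_iff hy hr).2 h)
    rw [if_neg hyr, Ioc_eq_empty hst, Measure.restrict_empty, integral_zero_measure]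

/-! ## §4. The model integral in ratio coordinates -/

/-- **THE UNIT-BOX MODEL INTEGRAL IN RATIO COORDINATES.** For `y > 0` and all `a, b`:
`∫_{u₁>0}∫_{u₂>0} 1[y<u₁u₂, u₁ ≤ 1, u₂ ≤ 1](log u₁)^a(log u₂)^b/(u₁+u₂)²
   = ∫_{y<r<1/y} (1+r)^{−2} Σ_{k≤b} C(b,k)(log r)^{b−k}((−max(log r,0))^{a+k+1} − (log(y/r)/2)^{a+k+1})/(a+k+1) dr`.
[cite: KowalskiMichelVanderKam2000, (22)–(28) — derivation (real-variable model of the residues of the diagonal weight)] -/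
theorem box_eq_ratio_integral {y : ℝ} (hy : 0 < y) (a b : ℕ) :
    ∫ u₁ in Ioi (0 : ℝ), ∫ u₂ in Ioi (0 : ℝ), (if 0 < u₁ ∧ 0 < u₂ ∧ y < u₁ * u₂ ∧ u₁ ≤ 1 ∧ u₂ ≤ 1 then
        Real.log u₁ ^ a * Real.log u₂ ^ b / (u₁ + u₂) ^ 2 else 0) =
      ∫ r in Ioo y y⁻¹, (∑ k ∈ Finset.range (b + 1), (b.choose k : ℝ) * Real.log r ^ (b - k) *
          ((-(max (Real.log r) 0)) ^ (a + k + 1) - (Real.log (y / r) / 2) ^ (a + k + 1)) / ((a : ℝ) + k + 1)) /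
          (1 + r) ^ 2 := by
  -- Step A: substitute in the inner integral
  have hA : ∫ u₁ in Ioi (0 : ℝ), ∫ u₂ in Ioi (0 : ℝ), (if 0 < u₁ ∧ 0 < u₂ ∧ y < u₁ * u₂ ∧ u₁ ≤ 1 ∧ u₂ ≤ 1 then
        Real.log u₁ ^ a * Real.log u₂ ^ b / (u₁ + u₂) ^ 2 else 0) =
      ∫ u₁ in Ioi (0 : ℝ), ∫ r in Ioi (0 : ℝ), (if 0 < u₁ ∧ 0 < r ∧ u₁ ≤ 1 ∧ u₁ * r ≤ 1 ∧ y < u₁ ^ 2 * r then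
        Real.log u₁ ^ a * Real.log (u₁ * r) ^ b / (u₁ * (1 + r) ^ 2) else 0) :=
    setIntegral_congr_fun measurableSet_Ioi fun u₁ hu₁ ↦ box_inner_subst y hu₁ a b
  -- Step B: Fubini
  have hB := integral_integral_swap (integrable_boxRatio hy a b)
  -- Step C: the inner `u`-integral
  have hC : ∫ r in Ioi (0 : ℝ), ∫ u₁ in Ioi (0 : ℝ), (if 0 < u₁ ∧ 0 < r ∧ u₁ ≤ 1 ∧ u₁ * r ≤ 1 ∧ y < u₁ ^ 2 * r then
        Real.log u₁ ^ a * Real.log (u₁ * r) ^ b / (u₁ * (1 + r) ^ 2) else 0) =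
      ∫ r in Ioi (0 : ℝ), (if y < r ∧ r < y⁻¹ then
        (∑ k ∈ Finset.range (b + 1), (b.choose k : ℝ) * Real.log r ^ (b - k) *
          ((-(max (Real.log r) 0)) ^ (a + k + 1) - (Real.log (y / r) / 2) ^ (a + k + 1)) / ((a : ℝ) + k + 1)) /
          (1 + r) ^ 2 else 0) :=
    setIntegral_congr_fun measurableSet_Ioi fun r hr ↦ box_ratio_inner hy hr a b
  rw [hA, hB, hC]
  -- restrict to `(y, 1/y)`
  have hind : (fun r : ℝ ↦ if y < r ∧ r < y⁻¹ then
        (∑ k ∈ Finset.range (b + 1), (b.choose k : ℝ) * Real.log r ^ (b - k) *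
          ((-(max (Real.log r) 0)) ^ (a + k + 1) - (Real.log (y / r) / 2) ^ (a + k + 1)) / ((a : ℝ) + k + 1)) /
          (1 + r) ^ 2 else 0) =
      (Ioo y y⁻¹).indicator fun r ↦ (∑ k ∈ Finset.range (b + 1), (b.choose k : ℝ) * Real.log r ^ (b - k) *
          ((-(max (Real.log r) 0)) ^ (a + k + 1) - (Real.log (y / r) / 2) ^ (a + k + 1)) / ((a : ℝ) + k + 1)) /
          (1 + r) ^ 2 := by
    funext r
    by_cases h : y < r ∧ r < y⁻¹
    · rw [if_pos h, indicator_of_mem (Set.mem_Ioo.2 h)]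
    · rw [if_neg h, indicator_of_notMem (fun hm ↦ h (Set.mem_Ioo.1 hm))]
  have hsub : Ioo y y⁻¹ ⊆ Ioi 0 := fun r hr ↦ hy.trans hr.1
  rw [hind, setIntegral_indicator measurableSet_Ioo, inter_eq_right.2 hsub]

end Summit.Parity.GeneralizedHardyLittlewood.Theorems.MomentsBeyondDiagonal.DiagLines

end
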